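import Summits.Ventures.YMGap.YM3IR.CovariantFamily
import Summits.Ventures.YMGap.RobustBall.StarRowsSU3PV2TWDim3
import HarnessLib

/-!
# YM3IR / BalabanCeilingsSU3PV2TW — the §Y4 sentence for `SU(3)` on the TIER-2 (weighted, infinite-range) ball at engine-2's
HYPOTHESIS-FREE PV2T-star W rows (TWISTED one-link Poincaré constant; Wilson `β_W = 3/5` at rate `1/100`; `β_W = 11/20` at rate
`log (6/5)`; the FAT working rows `11/20` and `1/2` at rate `1/100`) (theorems only; no new conjecture name)

HONEST FRAMING (cell pub-ymgap, track Y4 / YM3-IR, seat ym3ir-theory-1, gen 72 (staged); follow-up to `YM3IR/BalabanCeilingsSU3PV2W.lean`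
(tier-2 hypothesis-free PV2-star W rows, Wilson `1/2` at rate `1/100`, `12/25` at rate `log (6/5)`), written once engine-2 (g11)'s
`RobustBall/StarRowsSU3PV2TWDim3.lean` — the `d = 3` cells of ds-2's WEIGHTED robust vertex-star door in variance form fed with engine-2's
TWISTED Poincaré constant (`OneLinkModulusSU3Twisted.su3_pv2t_star_inputs`) × the CENTRED Schwinger–Dyson variance (PV2T), HYPOTHESIS-FREE
for `SU(3)` — is in the tree WITH COMMIT (`29dd74e5950b`), per R212 (iii).  This file claims NO summit, NO mass gap and NO part of Bałaban's
theorems.  It is kernel-checked BOOKKEEPING: `BalabanSUN.massGap3Cofinal_suN_balaban_of_irConjecture3` at `N = 3` with track Y2's input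
(`ClusterDomainClustering` on a TIER-2 ball `ClusterDomain κ_b ε₀ ε₁`) DISCHARGED BY NAME by engine-2's hypothesis-free cells
`RobustBall.su3_clusterDomainClusteringW_dim3_pv2tStar_threeFifths_t100 κ_b hκb` (tree ceiling `1/5` = Wilson `β_W = 3/5`, ball
`ClusterDomain κ_b (19/500) (19/1000)` for EVERY ball parameter `κ_b ≥ 1/100`, rate `1/100` — the highest HYPOTHESIS-FREE `SU(3)`
tier-2 `d = 3` ceiling in the tree; radius a door artefact), `RobustBall.su3_clusterDomainClusteringW_dim3_pv2tStar_elevenTwentieths_w65`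
(tree ceiling `11/60` = Wilson `11/20`, ball `ClusterDomain (log (6/5)) (21/500) (21/1000)`, weight AND rate `log (6/5)` — the highest
tier-2 row at the better rate), and the FAT working cells at rate `1/100`: `…_elevenTwentieths_t100 κ_b hκb` (tree `11/60`, ball
`ClusterDomain κ_b (27/250) (27/500)`) and `…_oneHalf_t100 κ_b hκb` (tree `1/6` = Wilson `1/2` on `ClusterDomain κ_b (89/500) (89/1000)
⊋ (7/125, 7/250)` of the PV2 W row at the same ceiling — a WEAKER hypothesis (a) by `YM3IR/BallMonotone.lean`,
`irConjecture3Cov_ball_mono`, hence a STRONGER sentence).  WHAT MOVES on the UV side: the HYPOTHESIS-FREE `SU(3)` receiving end of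
the §Y4 sentence ON THE BALL IN WHICH THE CONJECTURE OF RECORD IS TYPED (the weighted `ClusterDomain κ ε₀ ε₁` of `YM3IR/Statement.lean`)
rises from Wilson `1/2` (`BalabanCeilingsSU3PV2W`) to `3/5` (rate `1/100`) and from `12/25` to `11/20` at rate `log (6/5)`; the CERTIFIED
tier-2 row GIVEN H1, H2 (`BalabanCeilingsSU3CertifiedW`, Wilson `3/4`) is untouched and remains higher.  Lattice statements only;
strong-coupling constants; no continuum limit, no Millennium claim; no axiom, no `sorry`, no `def`; `0` compute.

THE HYPOTHESIS LIST, VERBATIM (`massGap3Cofinal_su3_W_pv2tStar_threeFifths_t100_of_irConjecture3`): `BalabanUV3 mk` — IN PRINT (Bałaban,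
CMP 102 (1985), Thm 1 p. 257 + Thm 2 p. 272), logically IDLE in the arrow (theory-2 F2; R196); `Nonempty (Family L eps0)` — print's
clauses at one coupling (p. 256 L15–18); `0 < C_b`, `0 < κ`; `1/100 ≤ κ_b` (the ball parameter);
`IRConjecture3 (ballOfRobustBall 3 κ_b (19/500) (19/1000) (1/5)) suFrobDist (fundamentalRep (Fin 3)) (balabanCouplings L (suGroupModel 3)
eps0) C_b κ` — the CONJECTURE of record (theory-2, `YM3IR/Statement.lean`; NOT in print).  LABEL OF RECORD (R196, verbatim): a typed
INTERFACE / dictionary, NOT a reduction — with existential `(C_b, κ)` the free-family conjecture is target-equivalent on every receiving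
ball in the tree (theory-2, `YM3IR/ForestWitness.lean`, `YM3IR/ForestWitnessSUN.lean`: the forest witness enters any ball containing
product Haar, the tier-2 balls included, `ForestWitnessSUN.forestWitness3_ball`); the covariant form `IRConjecture3Cov`
(`YM3IR/CovariantFamily.lean`) is a genuine sufficient condition, possibly strictly stronger, converse NOT known — never "the remaining
gap".  CONCLUSION: `MassGap3Cofinal (balabanCouplings L (suGroupModel 3) eps0) suFrobDist (fundamentalRep (Fin 3))`.

COUNTED CROSSOVER (PROVED arithmetic, in the tier-1 edition `YM3IR/BalabanCeilingsSU3PV2T.lean`, cited and NOT restated here — the gate's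
dedup rule): below the ceiling `1/5` after `K + M'` steps iff `L^{M'} ≥ 5/(3γ₀²)` (`su3_betaTree_div_pow_le_fifth_iff`), hence `5/3 ≤ L^{M'}`
and `M' ≥ 1` (`su3_fiveThirds_le_pow_of_betaTree_div_pow_le_fifth`); below `11/60` iff `L^{M'} ≥ 20/(11γ₀²)`
(`su3_betaTree_div_pow_le_11_60_iff`) — vs `2/γ₀²` at the PV2 W ceiling `1/6` and `4/(3γ₀²)` at the certified tier-2 `1/4`.

WHY THIS IS USEFUL (one sentence).  It records, by name and kernel-checked, the §Y4 sentence for the physical colour group on the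
weighted ball of `YM3IR/Statement.lean` with Y2's input a HYPOTHESIS-FREE theorem up to Wilson `β_W = 3/5`, above the `SU(2)` tier-2
ceiling (`BalabanCeilingsSU2W`, Wilson `1/2`) for the first time.

References: T. Bałaban, CMP 102 (1985) 255–275, p. 256 L15–18, (5) p. 256, Thm 1 p. 257, Thm 2 p. 272 [cite: Balaban1985UV3]; CMP 98
(1985) 17–51, (11), (15) p. 19 [cite: Balaban1985Averaging] (block locality = a property of the average (15), no numbered display);
D. Bakry, M. Émery (1985); H. Shen, R. Zhu, X. Zhu, CMP 400 (2023) Lemma 4.1 (the vertex σ-model dictionary behind the star rows;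
engine-2's file headers).
-/

noncomputable section

open MeasureTheory
open Literature.MathematicalPhysics.QuantumLattice Literature.MathematicalPhysics.QuantumFieldTheory
open Balaban1985CMP102 Balaban1985CMP102.Setting Balaban1985CMP102.Theorems
open Literature.MathematicalPhysics.QuantumFieldTheory.Balaban1983to89 (GaugeGroup HaarData)
open Summit.QuantumFields.Balaban3D.Carriers (suGroupModel)

namespace Summit.Ventures.YMGap.YM3IR

open CarrierBridge

/-! ## §1  Wilson `β_W = 3/5` on the weighted ball `ClusterDomain κ_b (19/500) (19/1000)`, rate `1/100`, every `κ_b ≥ 1/100` -/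

/-- **`SU(3)` lattice YM₃ mass gap on Bałaban's coupling set, receiving on the TIER-2 ball at Wilson `β_W = 3/5`, Y2's input
HYPOTHESIS-FREE (PROVED bookkeeping).**  engine-2's weighted PV2T-star cell
`RobustBall.su3_clusterDomainClusteringW_dim3_pv2tStar_threeFifths_t100 κ_b hκb` BY NAME (tree ceiling `1/5`, ball
`ClusterDomain κ_b (19/500) (19/1000)` for every `κ_b ≥ 1/100`, rate `1/100`).  The hypothesis that is neither in print nor certified is
`IRConjecture3` (label of record R196: a dictionary, not a reduction; `BalabanUV3 mk` is logically idle).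
[cite: Balaban1985UV3, Thm 1 p.257; Thm 2 p.272] -/
theorem massGap3Cofinal_su3_W_pv2tStar_threeFifths_t100_of_irConjecture3 {L : ℕ} {mk : Construction L} {eps0 : ℝ → ℝ}
    (hfam : Nonempty (Family L eps0)) {κ_b C_b κ : ℝ} (hκb : 1 / 100 ≤ κ_b) (hC : 0 < C_b) (hκ : 0 < κ)
    (hUV : BalabanUV3 mk)
    (hIR : IRConjecture3 (ballOfRobustBall 3 κ_b (19 / 500) (19 / 1000) (1 / 5)) suFrobDist (fundamentalRep (Fin 3))
      (balabanCouplings L (suGroupModel 3) eps0) C_b κ) :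
    MassGap3Cofinal (balabanCouplings L (suGroupModel 3) eps0) suFrobDist
      (fundamentalRep (Fin 3) : RobustBall.SUN 3 →* Matrix (Fin 3) (Fin 3) ℂ) :=
  massGap3Cofinal_suN_balaban_of_irConjecture3 hfam hC hκ (by norm_num : (0 : ℝ) < 1 / 100) hUV
    (RobustBall.su3_clusterDomainClusteringW_dim3_pv2tStar_threeFifths_t100 κ_b hκb).1 hIR

/-- **The COVARIANT §Y4 sentence on the tier-2 ball at Wilson `β_W = 3/5`, Y2's input HYPOTHESIS-FREE (PROVED bookkeeping; the shape
of `BalabanCeilingsSU3PV2W.massGap3Cofinal_su3_W_pv2Star_oneHalf_of_irConjecture3Cov`, ceiling `1/2 ↦ 3/5`).**  LABEL OF RECORD for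
`IRConjecture3Cov` (R196, verbatim): «⟹ target PROVED; converse NOT KNOWN; a genuine sufficient condition, possibly strictly stronger,
never "the remaining gap"». [cite: Balaban1985Averaging, (11), (15) p.19] -/
theorem massGap3Cofinal_su3_W_pv2tStar_threeFifths_t100_of_irConjecture3Cov {L : ℕ} {mk : Construction L} {eps0 : ℝ → ℝ}
    (hfam : Nonempty (Family L eps0)) {κ_b C_b κ : ℝ} (hκb : 1 / 100 ≤ κ_b) (hC : 0 < C_b) (hκ : 0 < κ)
    (hUV : BalabanUV3 mk)
    (hIR : IRConjecture3Cov (ballOfRobustBall 3 κ_b (19 / 500) (19 / 1000) (1 / 5)) suFrobDist (fundamentalRep (Fin 3))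
      (balabanCouplings L (suGroupModel 3) eps0) C_b κ) :
    MassGap3Cofinal (balabanCouplings L (suGroupModel 3) eps0) suFrobDist
      (fundamentalRep (Fin 3) : RobustBall.SUN 3 →* Matrix (Fin 3) (Fin 3) ℂ) :=
  massGap3Cofinal_su3_W_pv2tStar_threeFifths_t100_of_irConjecture3 hfam hκb hC hκ hUV (irConjecture3_of_cov hIR)

/-- **The same, PRINT-FREE (theory-2's F2 shape: `BalabanUV3 mk` and `mk` deleted; PROVED bookkeeping).**  What remains of print is
the index set `balabanCouplings` and its unboundedness — the kernel record that `BalabanUV3` is evidential in these sentences.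
[cite: Balaban1985UV3, p.256 L15–18] -/
theorem massGap3Cofinal_su3_W_pv2tStar_threeFifths_t100_of_irConjecture3Cov_printFree {L : ℕ} {eps0 : ℝ → ℝ}
    (hfam : Nonempty (Family L eps0)) {κ_b C_b κ : ℝ} (hκb : 1 / 100 ≤ κ_b) (hC : 0 < C_b) (hκ : 0 < κ)
    (hIR : IRConjecture3Cov (ballOfRobustBall 3 κ_b (19 / 500) (19 / 1000) (1 / 5)) suFrobDist (fundamentalRep (Fin 3))
      (balabanCouplings L (suGroupModel 3) eps0) C_b κ) :
    MassGap3Cofinal (balabanCouplings L (suGroupModel 3) eps0) suFrobDist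
      (fundamentalRep (Fin 3) : RobustBall.SUN 3 →* Matrix (Fin 3) (Fin 3) ℂ) :=
  massGap3Cofinal_of_irConjecture3_printFree (not_bddAbove_balabanCouplings (suGroupModel 3) hfam) hC hκ
    (by norm_num : (0 : ℝ) < 1 / 100) (suFrobDist_bddAbove 3)
    (RobustBall.su3_clusterDomainClusteringW_dim3_pv2tStar_threeFifths_t100 κ_b hκb).1 (irConjecture3_of_cov hIR)

/-- **In PRINT'S quantifier order on the tier-2 ball at `β_W = 3/5` (PROVED bookkeeping):** `∃ eps0` first (print, p. 256 L15–18), then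
for every ball parameter `κ_b ≥ 1/100` and every `C_b`, `κ`: `Nonempty (Family L eps0) → IRConjecture3` on the cell's ball (label of
record R196: a dictionary, not a reduction) `⟹ MassGap3Cofinal`. [cite: Balaban1985UV3, p.256 L15–18; Thm 2 p.272] -/
theorem massGap3Cofinal_su3_W_pv2tStar_threeFifths_t100_printedOrder_of_irConjecture3 {L : ℕ} (mk : Construction L)
    (hUV : BalabanUV3 mk) :
    ∃ eps0 : ℝ → ℝ, (∀ g : ℝ, 0 < g → 0 < eps0 g) ∧
      (∀ S : Family L eps0, ∀ k, k ≤ S.1.K → (mk (RobustBall.SUN 3) (suGroupModel 3) S.1).ineq41_47 k) ∧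
      ∀ (κ_b C_b κ : ℝ), 1 / 100 ≤ κ_b → 0 < C_b → 0 < κ → Nonempty (Family L eps0) →
        IRConjecture3 (ballOfRobustBall 3 κ_b (19 / 500) (19 / 1000) (1 / 5)) suFrobDist (fundamentalRep (Fin 3))
          (balabanCouplings L (suGroupModel 3) eps0) C_b κ →
          MassGap3Cofinal (balabanCouplings L (suGroupModel 3) eps0) suFrobDist
            (fundamentalRep (Fin 3) : RobustBall.SUN 3 →* Matrix (Fin 3) (Fin 3) ℂ) := by
  obtain ⟨eps0, hpos, h2, h⟩ := massGap3Cofinal_suN_balaban_printedOrder_of_irConjecture3 (N := 3) mk hUV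
  refine ⟨eps0, hpos, h2, fun κ_b C_b κ hκb hC hκ hfam hIR => ?_⟩
  exact h (ballOfRobustBall 3 κ_b (19 / 500) (19 / 1000) (1 / 5)) C_b κ (1 / 100) hC hκ (by norm_num) hfam
    (RobustBall.su3_clusterDomainClusteringW_dim3_pv2tStar_threeFifths_t100 κ_b hκb).1 hIR

/-! ## §2  Wilson `β_W = 11/20` at weight AND rate `log (6/5)` on `ClusterDomain (log (6/5)) (21/500) (21/1000)` -/

/-- **The §Y4 sentence on the tier-2 ball `ClusterDomain (log (6/5)) (21/500) (21/1000)` at Wilson `β_W = 11/20` (tree `11/60`), rate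
`log (6/5)`, Y2's input HYPOTHESIS-FREE (PROVED bookkeeping):** engine-2's cell
`RobustBall.su3_clusterDomainClusteringW_dim3_pv2tStar_elevenTwentieths_w65` BY NAME — the highest hypothesis-free `SU(3)` tier-2 `d = 3`
row at the rate `log (6/5)` (PV2 W: `12/25`).  Label of record R196 as in §1. [cite: Balaban1985UV3, Thm 2 p.272] -/
theorem massGap3Cofinal_su3_W_pv2tStar_elevenTwentieths_w65_of_irConjecture3 {L : ℕ} {mk : Construction L} {eps0 : ℝ → ℝ}
    (hfam : Nonempty (Family L eps0)) {C_b κ : ℝ} (hC : 0 < C_b) (hκ : 0 < κ) (hUV : BalabanUV3 mk)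
    (hIR : IRConjecture3 (ballOfRobustBall 3 (Real.log (6 / 5)) (21 / 500) (21 / 1000) (11 / 60)) suFrobDist (fundamentalRep (Fin 3))
      (balabanCouplings L (suGroupModel 3) eps0) C_b κ) :
    MassGap3Cofinal (balabanCouplings L (suGroupModel 3) eps0) suFrobDist
      (fundamentalRep (Fin 3) : RobustBall.SUN 3 →* Matrix (Fin 3) (Fin 3) ℂ) :=
  massGap3Cofinal_suN_balaban_of_irConjecture3 hfam hC hκ RobustBall.log_sixFifths_pos_and_log_threeHalves_pos.1 hUV
    RobustBall.su3_clusterDomainClusteringW_dim3_pv2tStar_elevenTwentieths_w65.1 hIR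

/-- **The COVARIANT form of §2 (PROVED bookkeeping).**  LABEL OF RECORD for `IRConjecture3Cov` (R196, verbatim) as in §1.
[cite: Balaban1985Averaging, (11), (15) p.19] -/
theorem massGap3Cofinal_su3_W_pv2tStar_elevenTwentieths_w65_of_irConjecture3Cov {L : ℕ} {mk : Construction L} {eps0 : ℝ → ℝ}
    (hfam : Nonempty (Family L eps0)) {C_b κ : ℝ} (hC : 0 < C_b) (hκ : 0 < κ) (hUV : BalabanUV3 mk)
    (hIR : IRConjecture3Cov (ballOfRobustBall 3 (Real.log (6 / 5)) (21 / 500) (21 / 1000) (11 / 60)) suFrobDist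
      (fundamentalRep (Fin 3)) (balabanCouplings L (suGroupModel 3) eps0) C_b κ) :
    MassGap3Cofinal (balabanCouplings L (suGroupModel 3) eps0) suFrobDist
      (fundamentalRep (Fin 3) : RobustBall.SUN 3 →* Matrix (Fin 3) (Fin 3) ℂ) :=
  massGap3Cofinal_su3_W_pv2tStar_elevenTwentieths_w65_of_irConjecture3 hfam hC hκ hUV (irConjecture3_of_cov hIR)

/-! ## §3  FAT working rows at rate `1/100`: Wilson `11/20` on `ClusterDomain κ_b (27/250) (27/500)` and Wilson `1/2` on
`ClusterDomain κ_b (89/500) (89/1000)` (`⊋ (7/125, 7/250)` of the PV2 W row at the same ceiling) -/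

/-- **The COVARIANT §Y4 sentence on the tier-2 ball `ClusterDomain κ_b (27/250) (27/500)` at Wilson `β_W = 11/20` (tree `11/60`), rate
`1/100`, every `κ_b ≥ 1/100`, Y2's input HYPOTHESIS-FREE (PROVED bookkeeping):** engine-2's cell
`RobustBall.su3_clusterDomainClusteringW_dim3_pv2tStar_elevenTwentieths_t100 κ_b hκb` BY NAME.  LABEL OF RECORD for `IRConjecture3Cov`
(R196, verbatim) as in §1. [cite: Balaban1985Averaging, (11), (15) p.19] -/
theorem massGap3Cofinal_su3_W_pv2tStar_elevenTwentieths_t100_of_irConjecture3Cov {L : ℕ} {mk : Construction L} {eps0 : ℝ → ℝ}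
    (hfam : Nonempty (Family L eps0)) {κ_b C_b κ : ℝ} (hκb : 1 / 100 ≤ κ_b) (hC : 0 < C_b) (hκ : 0 < κ)
    (hUV : BalabanUV3 mk)
    (hIR : IRConjecture3Cov (ballOfRobustBall 3 κ_b (27 / 250) (27 / 500) (11 / 60)) suFrobDist (fundamentalRep (Fin 3))
      (balabanCouplings L (suGroupModel 3) eps0) C_b κ) :
    MassGap3Cofinal (balabanCouplings L (suGroupModel 3) eps0) suFrobDist
      (fundamentalRep (Fin 3) : RobustBall.SUN 3 →* Matrix (Fin 3) (Fin 3) ℂ) :=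
  massGap3Cofinal_suN_balaban_of_irConjecture3 hfam hC hκ (by norm_num : (0 : ℝ) < 1 / 100) hUV
    (RobustBall.su3_clusterDomainClusteringW_dim3_pv2tStar_elevenTwentieths_t100 κ_b hκb).1 (irConjecture3_of_cov hIR)

/-- **The COVARIANT §Y4 sentence on the FAT tier-2 working ball `ClusterDomain κ_b (89/500) (89/1000)` at Wilson `β_W = 1/2` (tree `1/6`),
rate `1/100`, every `κ_b ≥ 1/100`, Y2's input HYPOTHESIS-FREE (PROVED bookkeeping):** engine-2's cell
`RobustBall.su3_clusterDomainClusteringW_dim3_pv2tStar_oneHalf_t100 κ_b hκb` BY NAME — the ball `(89/500, 89/1000)` strictly contains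
`BalabanCeilingsSU3PV2W`'s `(7/125, 7/250)` at the same ceiling and weight, so this sentence implies that one
(`BallMonotone.sentence_cov_of_le` with `inBall_ballOfRobustBall_mono`).  LABEL OF RECORD for `IRConjecture3Cov` (R196, verbatim) as in
§1. [cite: Balaban1985Averaging, (11), (15) p.19] -/
theorem massGap3Cofinal_su3_W_pv2tStar_oneHalf_t100_of_irConjecture3Cov {L : ℕ} {mk : Construction L} {eps0 : ℝ → ℝ}
    (hfam : Nonempty (Family L eps0)) {κ_b C_b κ : ℝ} (hκb : 1 / 100 ≤ κ_b) (hC : 0 < C_b) (hκ : 0 < κ)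
    (hUV : BalabanUV3 mk)
    (hIR : IRConjecture3Cov (ballOfRobustBall 3 κ_b (89 / 500) (89 / 1000) (1 / 6)) suFrobDist (fundamentalRep (Fin 3))
      (balabanCouplings L (suGroupModel 3) eps0) C_b κ) :
    MassGap3Cofinal (balabanCouplings L (suGroupModel 3) eps0) suFrobDist
      (fundamentalRep (Fin 3) : RobustBall.SUN 3 →* Matrix (Fin 3) (Fin 3) ℂ) :=
  massGap3Cofinal_suN_balaban_of_irConjecture3 hfam hC hκ (by norm_num : (0 : ℝ) < 1 / 100) hUV
    (RobustBall.su3_clusterDomainClusteringW_dim3_pv2tStar_oneHalf_t100 κ_b hκb).1 (irConjecture3_of_cov hIR)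

end Summit.Ventures.YMGap.YM3IR

end
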